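import Summits.QuantumFields.YangMills.Theorems.SpecificationCompactnessStubSpecificationFromCocycle
import Summits.QuantumFields.YangMills.Theorems.SpecificationCompactnessUnitDensityPosAE

/-!
# Route `SpecificationCompactness`, LINE 15 «cocycle_limit» (crux `SpecificationLimitAE`, stmt-QuantumFields-22688): the REGISTERED
# STUB D `stub_unitDensityPosAE` BY NAME AND SIGNATURE

The skeleton's abbreviations and the registered aliases `__Registered.*` already live in the tree
(`Theorems.SpecificationCompactnessStubSpecificationFromCocycle`, width seat w3 g27, verbatim from the planner's
`SpecificationLimitAE_cocycle.lean`); this file proves the registered stub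

  `theorem stub_unitDensityPosAE : __Registered.stub_unitDensityPosAE`

(`UnitDensityPosAE : ∀ F γ, 0 < γ → ∀ K, ∀ᵐ V ∂(pi0 F), 0 < ud F γ K V`) by the landed theorem
`Theorems.UnitDensityPosAE.unitDensityPosAE` (reverse absolute continuity of Bałaban's (0.4) averaging push-forward,
`Theorems.AveragingReverseAC`, + the Radon–Nikodym induction).  Cell ym-idea-1 width seat ym-line-sfw-p2-w2 g21 (free hands) for
planner ym-idea-5's LINE 15.  HONEST FRAMING: stubs A `stub_cocycleLimitInMeasure`, C `stub_fibreUI` and the BC5 rung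
`stub_smallFieldCocycleLimit` are NOT proved here; no crux, route, rung or mass gap is proved.
-/

noncomputable section

namespace Summit.QuantumFields.YangMills.Cruxes.SpecificationLimitAE.CocycleLimit

/-- **STUB D `stub_unitDensityPosAE` HOLDS**: Bałaban's renormalised unit density `ρ̂_K` ([Balaban1985UV3] (2)) is positive
`π₀`-almost everywhere for every family `F`, every `γ > 0` and every `K` (reverse absolute continuity of the (0.4) averaging).
[cite: Balaban1985UV3, (2) p.256] -/
theorem stub_unitDensityPosAE : __Registered.stub_unitDensityPosAE :=
  Summit.QuantumFields.YangMills.Theorems.UnitDensityPosAE.unitDensityPosAE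

end Summit.QuantumFields.YangMills.Cruxes.SpecificationLimitAE.CocycleLimit

end
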